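import Summits.QuantumFields.YangMills.Theorems.AllWindowsColdBoxBoxHighLineSmearedFPOperator
import Summits.QuantumFields.YangMills.Theorems.AllWindowsColdBoxBoxHighLineSmearedFPPauli
import Summits.QuantumFields.YangMills.Theorems.AllWindowsColdBoxBoxHighLineSmearedFPOrbit

/-!
# T-S5 STEP 2 — the EDGE CHART of the cold box and the first chart-dependent bricks (task statements, planner ym-idea-2 g18)

Definitions shared by every chart-dependent brick of `STUB-PLAN-S5-STEP2.md` §2–§4 (crux dir `Cruxes/BoxHighWindowsSU22/`), and three task
Props provable now, by name, `--supports stmt-QuantumFields-24004`: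

* the edge chart `edgeChart H a` (`a : LandauFree H → ℝ³`, `U_e = expPauli(a_e)` on the box edges, `1` elsewhere — `LandauFree H` is EVERY
  edge of the cold box, no forest), the per-colour Hodge form `boxQuadForm H a = Σ_c a^c·hodgeQ·a^c`, the box Wilson action `boxWilson`
  (the tree's `wilsonBoundaryAction` of the box at `N = 2`), the Haar chart weight `chartHaarWeight = Π_e σ(‖a_e‖)`, the chart domain, the
  small-field sets, and the smooth FP-chart weight `fpChartWeight β H r a = χ_r · exp(−β(S + Φ)) · |det F_FP| · Π σ` (all at `U = edgeChart H a`);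
* **T-S5.14 `BoxStateEdgeChart`** (S/M, measure plumbing): the cold-box state in the edge chart,
  `∫ F dboxState = (∫_{chart} F(U(a)) e^{−β S(U(a))} Πσ da) / (∫_{chart} e^{−β S} Πσ da)` (`ymSpecification` = tilted glued product Haar;
  ✓`measurePreserving_pi_expPauli` / ✓`integral_haarProbability_eq_pauli`);
* **T-S5.6a `ActionSandwich`** (M): `|S(U(a)) + Φ(U(a)) − boxQuadForm H a| ≤ C·t·H·boxQuadForm H a` when all `‖a_e‖ ≤ t`, `t·H ≤ c₀`
  (quaternion BCH to second order per plaquette, `imVec ∘ expPauli = sinc·P`, Cauchy–Schwarz, and `Σ_e‖a_e‖² ≤ (H²/c₁)·boxQuadForm` from ✓S1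
  `HodgePoincareColdBox`; the hypothesis `t·H ≤ c₀` is NECESSARY — smooth fields of size `t ≫ 1/H` violate the bound);
* **T-S5.6 `SmallFieldInsideFP`** (M): the FP-chart weight gives the complement of the small-field set `{‖a_e‖ ≤ s}` mass
  `≤ C·H⁴·exp(C·r·H⁵ − c·β·s²)` relative to the half-radius set — route (6a)+(6b)+(6c)+(6d) of the plan: two-sided Gaussian domination at `1 ± C r H`,
  determinant ratio `e^{±C}` (✓4c-E, ✓4f, ✓4r, T-S5.9 sup part), Haar ratio, Gaussian single-edge tails by ✓S3a `LandauVarianceBounded`.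

HONEST LABEL: definitions and task statements only; S5 (`stub_landauSecondOrder`), ⟨stmt-QuantumFields-24004⟩ ⟨24335⟩ ⟨24336⟩ remain OPEN; route
AllWindowsColdBox is DRAFT; no rung is proved; the Yang–Mills mass gap is NOT proved by this file.
-/

set_option autoImplicit false

noncomputable section

open MeasureTheory Matrix Finset Real
open Literature.MathematicalPhysics.QuantumFieldTheory.AxialGauge (boxEdges)
open Literature.MathematicalPhysics.QuantumFieldTheory.LatticeMaxwell (boxEdgesAt)
open Literature.MathematicalPhysics.QuantumFieldTheory.Balaban1983to89.B10Eq18SigmaSU2Haar (expPauli)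
open Literature.MathematicalPhysics.QuantumFieldTheory.Balaban1983to89.B10Eq22Rescaling (sigmaSU2)
open Literature.MathematicalPhysics.QuantumLattice (gaugeTransformZd LGConfig ZdEdge wilsonBoundaryAction fundamentalRep)
open Summit.QuantumFields.YangMills.Theorems.WeakCouplingRates (boxState dirCorner)

namespace Summit.QuantumFields.YangMills.Theorems.AllWindowsColdBoxBoxHighLine

/-- `ℝ³` with its Euclidean norm (the domain of the tree's chart `expPauli`). -/
abbrev E3 : Type := EuclideanSpace ℝ (Fin 3)

/-! ## The edge chart -/

/-- Zero extension of a free edge field to all edges of `ℤ⁴` (`LandauFree H` = the box edges inside the enlarged block). -/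
def freeVec (H : ℕ) (a : LandauFree H → E3) (e : ZdEdge 4) : E3 :=
  if h : e ∈ boxEdgesAt dirCorner (2 * H + 3) then
    (if h' : e ∈ boxEdges 4 (2 * H + 1) then a ⟨⟨e, h⟩, not_not_intro h'⟩ else 0)
  else 0

/-- **The edge chart**: `U_e = expPauli(a_e)` on the box edges, `U_e = 1` elsewhere (`expPauli 0 = 1`). -/
def edgeChart (H : ℕ) (a : LandauFree H → E3) : LGConfig 4 SU2 := fun e => expPauli (freeVec H a e)

/-- The colour-`c` component of an edge field, as a vector over the free edges. -/
def colour {H : ℕ} (a : LandauFree H → E3) (c : Fin 3) : LandauFree H → ℝ := fun e => a e c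

/-- **The Hodge quadratic form of the chart**, summed over colours: `Σ_c a^c · hodgeQ H · a^c` (the exponent of the STEP-2 Gaussian is `−β` times it). -/
def boxQuadForm (H : ℕ) (a : LandauFree H → E3) : ℝ := ∑ c : Fin 3, colour a c ⬝ᵥ (hodgeQ H *ᵥ colour a c)

/-- **The box Wilson action with boundary plaquettes** (`N = 2`, fundamental `SU(2)`): the exponent of `boxState` is `−β` times it. -/
def boxWilson (H : ℕ) (U : LGConfig 4 SU2) : ℝ := wilsonBoundaryAction (fundamentalRep (Fin 2)) (boxEdges 4 (2 * H + 1)) U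

/-- The Haar chart weight `Π_e σ_{SU(2)}(‖a_e‖)` (`σ` includes the factor `1/(2π²)`). -/
def chartHaarWeight (H : ℕ) (a : LandauFree H → E3) : ℝ := ∏ e : LandauFree H, sigmaSU2 ‖a e‖

/-- The chart domain: every edge variable in the injectivity ball `‖a_e‖ < π`. -/
def chartDomain (H : ℕ) : Set (LandauFree H → E3) := {a | ∀ e, ‖a e‖ < Real.pi}

/-- The small-field set of radius `s`: every `‖a_e‖ ≤ s`. -/
def smallField (H : ℕ) (s : ℝ) : Set (LandauFree H → E3) := {a | ∀ e, ‖a e‖ ≤ s}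

/-- **The smooth FP-chart weight** `w_J(a) = χ_r(U) · exp(−β(S(U) + Φ(U))) · |det F_FP(U)| · Π_e σ(‖a_e‖)`, `U = edgeChart H a`
(the gauge-fixed cold-box density in the chart, WITHOUT the gauge-ball indicator and the orbit normaliser, which the assembly handles). -/
def fpChartWeight (β : ℝ) (H : ℕ) (r : ℝ) (a : LandauFree H → E3) : ℝ :=
  ballCutoff H r (edgeChart H a) * Real.exp (-(β * (boxWilson H (edgeChart H a) + landauPhi H (edgeChart H a)))) *
    |(fpOperator H (edgeChart H a)).det| * chartHaarWeight H a

/-! ## Task statements -/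

/-- **T-S5.14 `BoxStateEdgeChart`** — the cold-box state in the edge chart: for every `boxState`-integrable `F`,
`∫ F dboxState β H = (∫_{chartDomain} F(U(a)) · e^{−β S(U(a))} · Π σ(‖a_e‖) da) / (∫_{chartDomain} e^{−β S(U(a))} · Π σ(‖a_e‖) da)`. -/
def BoxStateEdgeChart : Prop :=
  ∀ (β : ℝ) (H : ℕ) (F : LGConfig 4 SU2 → ℝ), Integrable F (boxState (fundamentalRep (Fin 2)) β H) →
    ∫ U, F U ∂(boxState (fundamentalRep (Fin 2)) β H) =
      (∫ a in chartDomain H, F (edgeChart H a) * Real.exp (-(β * boxWilson H (edgeChart H a))) * chartHaarWeight H a) /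
        (∫ a in chartDomain H, Real.exp (-(β * boxWilson H (edgeChart H a))) * chartHaarWeight H a)

/-- **T-S5.6a `ActionSandwich`** — the action plus the gauge-fixing functional is the Hodge form up to a RELATIVE error `C·t·H` on fields with all
`‖a_e‖ ≤ t`, `t·H ≤ c₀`: `|S(U(a)) + Φ(U(a)) − boxQuadForm H a| ≤ C·t·H·boxQuadForm H a`. -/
def ActionSandwich : Prop :=
  ∃ C c₀ : ℝ, 0 < c₀ ∧ ∀ H : ℕ, 1 ≤ H → ∀ t : ℝ, 0 ≤ t → t * (H : ℝ) ≤ c₀ → ∀ a : LandauFree H → E3, (∀ e, ‖a e‖ ≤ t) →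
    |boxWilson H (edgeChart H a) + landauPhi H (edgeChart H a) - boxQuadForm H a| ≤ C * t * H * boxQuadForm H a

/-- **T-S5.6 `SmallFieldInsideFP`** — inside the Faddeev–Popov weight the complement of the small-field set is exponentially rare:
for `H ≥ 1`, `β ≥ 1`, `0 < s`, `4s ≤ r`, `r·H² ≤ c₀`, `C(1 + log H) ≤ β s²`,
`∫_{chartDomain ∖ smallField s} w_J ≤ C·H⁴·exp(C·r·H⁵ − c·β·s²) · ∫_{smallField (s/2)} w_J`. -/
def SmallFieldInsideFP : Prop :=
  ∃ C c c₀ : ℝ, 0 < c ∧ 0 < c₀ ∧ ∀ H : ℕ, 1 ≤ H → ∀ β r s : ℝ, 1 ≤ β → 0 < s → 4 * s ≤ r → r * (H : ℝ) ^ 2 ≤ c₀ →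
    C * (1 + Real.log H) ≤ β * s ^ 2 →
    ∫ a in chartDomain H \ smallField H s, fpChartWeight β H r a ≤
      C * (H : ℝ) ^ 4 * Real.exp (C * r * (H : ℝ) ^ 5 - c * β * s ^ 2) * ∫ a in smallField H (s / 2), fpChartWeight β H r a

/-! Sanity: the chart at `a = 0` is the cold configuration. -/
example (H : ℕ) (e : ZdEdge 4) : freeVec H 0 e = 0 := by
  unfold freeVec; split_ifs <;> rfl

example : BoxStateEdgeChart → ActionSandwich → SmallFieldInsideFP → True := fun _ _ _ => trivial

end Summit.QuantumFields.YangMills.Theorems.AllWindowsColdBoxBoxHighLine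

end
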